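import Mathlib
import Literature.AlgebraicGeometry.Resolution.AffineBlowupAlgebra

/-!
# `SectionCriterion` (stmt-ResolutionOfSingularities-15962), helper: a non-closed point of a fibre has a transcendental coordinate

Route `ResolutionOfSingularities/SectionAscent`, support item `SectionCriterion`.
`exists_transcendental_blowupAlgebraGens`: if `Q < Q'` are primes of the affine blowup algebra `A[I/g]`
lying over the same prime of `A` (a point of `Bl_I(Spec A)` that is not closed in its fibre), then some
generator `x/g`, `x ∈ I`, is transcendental over `K` modulo `Q` (otherwise `A[I/g]/Q` would be integral
over the image of `A`, contradicting incomparability). This is the input that makes the generic member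
`Σ t_j ⊗ h_j` pass through a point above `Q` over `K(t)`.

Proved by the wave-1 stub-worker of line `registered` of crux `GenericLevel` (stmt-…-15959); sorry-free,
no named facts. [folklore]
-/

set_option linter.dupNamespace false

open Literature.AlgebraicGeometry.Resolution

namespace Summit.ResolutionOfSingularities.ResolutionOfSingularities.Theorems

/-- **A point of a chart `Spec A[I/g]` that is not closed in its fibre has a transcendental
coordinate.** If `Q < Q'` are primes of the affine blowup algebra `A[I/g]` over the same prime of
`A`, then some generator `x/g` (`x ∈ I`) is transcendental over `K` modulo `Q`: otherwise `A[I/g]/Q`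
is integral over `A`, and an integral extension has no chain of two primes over one prime
(Mathlib `Ideal.comap_lt_comap_of_integral_mem_sdiff`). [folklore] -/
theorem exists_transcendental_blowupAlgebraGens {K A : Type*} [Field K] [CommRing A] [Algebra K A]
    {I : Ideal A} {g : A} (Q Q' : Ideal (blowupAlgebra I g)) [Q.IsPrime] [Q'.IsPrime]
    (hlt : Q < Q')
    (hcomap : Q.comap (algebraMap A (blowupAlgebra I g)) =
      Q'.comap (algebraMap A (blowupAlgebra I g))) :
    ∃ u : blowupAlgebra I g, (u : Localization.Away g) ∈ blowupAlgebraGens I g ∧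
      Transcendental K (Ideal.Quotient.mk Q u) := by
  classical
  let π : blowupAlgebra I g →ₐ[A] blowupAlgebra I g ⧸ Q := Ideal.Quotient.mkₐ A Q
  have hπ : ∀ b, π b = Ideal.Quotient.mk Q b := fun _ => rfl
  by_contra hcon
  push Not at hcon
  -- every element of `A[I/g]/Q` is integral over `A`
  let S : Subalgebra A (blowupAlgebra I g) := (integralClosure A (blowupAlgebra I g ⧸ Q)).comap π
  have hS : ∀ b : blowupAlgebra I g, b ∈ S := by
    rintro ⟨a, ha⟩
    induction ha using Algebra.adjoin_induction with
    | mem x hx =>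
      have h := hcon ⟨x, Algebra.subset_adjoin hx⟩ hx
      rw [Transcendental, not_not] at h
      change π _ ∈ integralClosure A (blowupAlgebra I g ⧸ Q)
      rw [mem_integralClosure_iff, hπ]
      exact IsIntegral.tower_top (A := A) h.isIntegral
    | algebraMap r => exact S.algebraMap_mem r
    | add x y hx hy ihx ihy => exact S.add_mem ihx ihy
    | mul x y hx hy ihx ihy => exact S.mul_mem ihx ihy
  have hint : ∀ b : blowupAlgebra I g, IsIntegral A (Ideal.Quotient.mk Q b) := fun b => by
    have h2 : π b ∈ integralClosure A (blowupAlgebra I g ⧸ Q) := hS b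
    rwa [mem_integralClosure_iff, hπ] at h2
  -- a chain of two primes over one prime in an integral extension: impossible
  obtain ⟨q', hq'Q', hq'Q⟩ := SetLike.exists_of_lt hlt
  have h1 : (⊥ : Ideal (blowupAlgebra I g ⧸ Q)).comap (algebraMap A (blowupAlgebra I g ⧸ Q)) <
      (Q'.map (Ideal.Quotient.mk Q)).comap (algebraMap A (blowupAlgebra I g ⧸ Q)) :=
    Ideal.comap_lt_comap_of_integral_mem_sdiff (I := ⊥) (J := Q'.map (Ideal.Quotient.mk Q)) bot_le
      (Set.mem_sdiff_of_mem (Ideal.mem_map_of_mem _ hq'Q') fun h =>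
        hq'Q (Ideal.Quotient.eq_zero_iff_mem.mp (Ideal.mem_bot.mp h)))
      (hint q')
  have hAQ : algebraMap A (blowupAlgebra I g ⧸ Q) = (Ideal.Quotient.mk Q).comp (algebraMap A (blowupAlgebra I g)) := by
    rw [IsScalarTower.algebraMap_eq A (blowupAlgebra I g) (blowupAlgebra I g ⧸ Q), Ideal.Quotient.algebraMap_eq]
  have e1 : (⊥ : Ideal (blowupAlgebra I g ⧸ Q)).comap (algebraMap A (blowupAlgebra I g ⧸ Q)) = Q.comap (algebraMap A (blowupAlgebra I g)) := by
    rw [hAQ, ← Ideal.comap_comap, ← RingHom.ker_eq_comap_bot, Ideal.mk_ker]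
  have e2 : (Q'.map (Ideal.Quotient.mk Q)).comap (algebraMap A (blowupAlgebra I g ⧸ Q)) =
      Q'.comap (algebraMap A (blowupAlgebra I g)) := by
    rw [hAQ, ← Ideal.comap_comap, Ideal.comap_map_of_surjective _ Ideal.Quotient.mk_surjective,
      ← RingHom.ker_eq_comap_bot, Ideal.mk_ker, sup_eq_left.mpr hlt.le]
  rw [e1, e2, hcomap] at h1
  exact lt_irrefl _ h1

end Summit.ResolutionOfSingularities.ResolutionOfSingularities.Theorems
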